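import Summits.QuantumAdvantage.AdviceFreeQNC0.CubeDistributions
import Literature.Computability.MetaComplexity.SmolenskyCorrelationRestrict
import Literature.Computability.MetaComplexity.SmolenskyParity
import Literature.Computability.MetaComplexity.RazborovSmolenskyPoly
import HarnessLib

/-!
# Cell qa-qnc0 (rung F-Q2-odd, `p = 3`): `MOD₃` of block parities is unpredictable by low-degree `𝔽₃`-polynomials

Planner qa-qnc0-p1 g16, `ROUND-15.md` §3.6 (the "structured endgame", formalisation map L6), for THEOREM A′
`PredHardDWB3` (`DWalkNormalForm.lean`).  LEMMA S, self-contained: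

on the cube `{0,1}^{K·ℓ}` cut into `K` blocks of `ℓ` bits with block parities `p_j(c)`, the target
`T(c) = t₀ + Σ_j η_j·(−1)^{p_j(c)} ∈ 𝔽₃` (`η_j ≠ 0`) is predicted by an `𝔽₃`-polynomial `F` of degree `≤ D` on
at most
  **`2^{Kℓ}·(1/3 + (2/3)·2^{−K} + 6·2^K·D/√ℓ)`**
points (`card_agree_target_le`, in `BlockParityTarget.lean`).  THIS file: the tools.  Proof idea: Walsh expansion of `[τ(p) = t]` over the `K` parity bits
(`walsh_inversion`, characters `CubeDistr.chi` of `CubeDistributions.lean`); the trivial character carries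
`#{p : τ(p) = t} ≤ (2^K + 2)/3` (`three_mul_card_affine_zmod3`, `DWalkOneBell.lean`); every other character is a
parity of `≥ ℓ` input bits, whose correlation with the `0/1`-valued degree-`2D` polynomial `[F = t] = 1 − (F − t)²` is
at most `2D·C(m, m/2)·2^{Kℓ−m} ≤ 2D·2^{Kℓ}/√m` by Smolensky's bound for subset parities
(`Smolensky.paritySubset_agreement_le`, applied to `Q`, `1 − Q`, and — for the exact balance of the parity classes —
to the constants `1`, `0` at degree `0`).

WHAT THIS IS NOT: no statement about the D-walk itself (the gauge transport that reduces `PredHardDWB3` to this lemma is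
the next file of the line); separation NOT moved.
-/

noncomputable section

namespace Summit.QuantumAdvantage.AdviceFreeQNC0

namespace BlockParity

open Finset
open Literature.Computability.MetaComplexity Literature.Computability.MetaComplexity.Smolensky

variable {K ℓ : ℕ}

/-! ### Blocks, block parities, the target -/

/-- Coordinate `s` of block `j`: `j·ℓ + s`. -/
def idx (j : Fin K) (s : Fin ℓ) : Fin (K * ℓ) := finProdFinEquiv (j, s)

/-- The coordinates of block `j`. -/
def block (j : Fin K) : Finset (Fin (K * ℓ)) := univ.image (idx (ℓ := ℓ) j)

/-- The parity of block `j` of `c` (as a Boolean). -/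
def bpar (c : Fin (K * ℓ) → Bool) (j : Fin K) : Bool :=
  decide (((block (ℓ := ℓ) j).filter fun i => c i = true).card % 2 = 1)

/-- `τ(q) = t₀ + Σ_j η_j·(−1)^{q_j}` on the parity cube `{0,1}^K`. -/
def tau (t₀ : ZMod 3) (η : Fin K → ZMod 3) (q : Fin K → Bool) : ZMod 3 :=
  t₀ + ∑ j, η j * (if q j = true then -1 else 1)

/-- The target `T(c) = τ(p(c))`, `p(c)` the vector of block parities. -/
def target (t₀ : ZMod 3) (η : Fin K → ZMod 3) (c : Fin (K * ℓ) → Bool) : ZMod 3 :=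
  tau t₀ η (bpar (ℓ := ℓ) c)

/-- `idx j` is injective. -/
theorem idx_injective (j : Fin K) : Function.Injective (idx (ℓ := ℓ) j) := fun s s' h => by
  have := finProdFinEquiv.injective h
  simpa using this

/-- `idx j s ∈ block j' ↔ j = j'`. -/
theorem idx_mem_block_iff (j j' : Fin K) (s : Fin ℓ) : idx j s ∈ block (ℓ := ℓ) j' ↔ j = j' := by
  unfold block
  rw [mem_image]
  constructor
  · rintro ⟨s', _, h⟩
    have := finProdFinEquiv.injective h
    simp only [Prod.mk.injEq] at this
    exact this.1.symm
  · rintro rfl; exact ⟨s, mem_univ _, rfl⟩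

/-- A block has `ℓ` coordinates. -/
theorem card_block (j : Fin K) : (block (ℓ := ℓ) j).card = ℓ := by
  unfold block
  rw [card_image_of_injective _ (idx_injective j), card_univ, Fintype.card_fin]

/-- Distinct blocks are disjoint. -/
theorem block_disjoint {j j' : Fin K} (h : j ≠ j') : Disjoint (block (ℓ := ℓ) j) (block (ℓ := ℓ) j') := by
  rw [Finset.disjoint_left]
  intro i hi hi'
  unfold block at hi
  obtain ⟨s, _, rfl⟩ := mem_image.1 hi
  exact h ((idx_mem_block_iff j j' s).1 hi')

/-! ### Walsh expansion on the parity cube -/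

/-- **Walsh inversion** on `{0,1}^K`: `f(p) = 2^{−K} Σ_a (Σ_q f(q) χ_a(q)) χ_a(p)`. -/
theorem walsh_inversion (f : (Fin K → Bool) → ℝ) (p : Fin K → Bool) :
    f p = (1 / (2 : ℝ) ^ K) * ∑ a : Fin K → Bool, (∑ q, f q * CubeDistr.chi a q) * CubeDistr.chi a p := by
  have h : ∑ a : Fin K → Bool, (∑ q, f q * CubeDistr.chi a q) * CubeDistr.chi a p = (2 : ℝ) ^ K * f p := by
    calc ∑ a : Fin K → Bool, (∑ q, f q * CubeDistr.chi a q) * CubeDistr.chi a p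
        = ∑ a : Fin K → Bool, ∑ q, f q * CubeDistr.chi a (CubeDistr.bxor q p) := by
          refine Finset.sum_congr rfl fun a _ => ?_
          rw [Finset.sum_mul]
          refine Finset.sum_congr rfl fun q _ => ?_
          rw [CubeDistr.chi_bxor]; ring
      _ = ∑ q, f q * ∑ a : Fin K → Bool, CubeDistr.chi a (CubeDistr.bxor q p) := by
          rw [Finset.sum_comm]
          refine Finset.sum_congr rfl fun q _ => ?_
          rw [Finset.mul_sum]
      _ = ∑ q, f q * (if CubeDistr.bxor q p = (fun _ => false) then (2 : ℝ) ^ K else 0) := by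
          refine Finset.sum_congr rfl fun q _ => by rw [CubeDistr.sum_chi]
      _ = (2 : ℝ) ^ K * f p := by
          rw [Finset.sum_eq_single p]
          · rw [if_pos ((CubeDistr.bxor_eq_zero_iff p p).2 rfl)]; ring
          · intro q _ hq; rw [if_neg (fun h => hq ((CubeDistr.bxor_eq_zero_iff q p).1 h)), mul_zero]
          · intro h; exact absurd (mem_univ p) h
  rw [h]; field_simp

/-- The trivial character is `1`. -/
theorem chi_zero (q : Fin K → Bool) : CubeDistr.chi (fun _ => false) q = 1 := by
  unfold CubeDistr.chi
  simp

/-- `|Σ_q f(q) χ_a(q)| ≤ 2^K` for `f` with values in `[0,1]`. -/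
theorem abs_walsh_coeff_le (f : (Fin K → Bool) → ℝ) (hf : ∀ q, 0 ≤ f q ∧ f q ≤ 1) (a : Fin K → Bool) :
    |∑ q, f q * CubeDistr.chi a q| ≤ (2 : ℝ) ^ K := by
  calc |∑ q, f q * CubeDistr.chi a q| ≤ ∑ q, |f q * CubeDistr.chi a q| := Finset.abs_sum_le_sum_abs _ _
    _ ≤ ∑ _q : Fin K → Bool, (1 : ℝ) := Finset.sum_le_sum fun q _ => by
        rw [abs_mul, CubeDistr.abs_chi, mul_one, abs_of_nonneg (hf q).1]; exact (hf q).2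
    _ = (2 : ℝ) ^ K := by simp

/-! ### The character `χ_a(p(c))` is the parity of a union of blocks -/

/-- The union of the blocks selected by `a`. -/
def blockUnion (a : Fin K → Bool) : Finset (Fin (K * ℓ)) := (univ.filter fun j => a j = true).biUnion (block (ℓ := ℓ))

/-- Its size is `ℓ·#{j : a_j}`. -/
theorem card_blockUnion (a : Fin K → Bool) :
    (blockUnion (ℓ := ℓ) a).card = ℓ * (univ.filter fun j => a j = true).card := by
  unfold blockUnion
  rw [card_biUnion (fun j _ j' _ h => block_disjoint h)]
  simp [card_block, mul_comm]

/-- A sum of naturals is odd iff an odd number of its terms are odd. -/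
private theorem sum_mod_two_eq_card_odd {ι : Type*} (s : Finset ι) (n : ι → ℕ) :
    (∑ i ∈ s, n i) % 2 = (s.filter fun i => n i % 2 = 1).card % 2 := by
  classical
  induction s using Finset.induction_on with
  | empty => simp
  | insert a s ha ih =>
    rw [sum_insert ha, filter_insert, Nat.add_mod, ih]
    by_cases h : n a % 2 = 1
    · rw [if_pos h, card_insert_of_notMem (fun h' => ha (mem_filter.1 h').1)]; omega
    · rw [if_neg h]; have : n a % 2 = 0 := by omega
      rw [this]; omega

/-- **`χ_a(p(c))` is `(−1)^{parity of c on the union of the selected blocks}`.** -/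
theorem chi_bpar_eq (a : Fin K → Bool) (c : Fin (K * ℓ) → Bool) :
    CubeDistr.chi a (bpar (ℓ := ℓ) c) =
      if ((blockUnion (ℓ := ℓ) a).filter fun i => c i = true).card % 2 = 1 then -1 else 1 := by
  unfold CubeDistr.chi
  have hcard : ((blockUnion (ℓ := ℓ) a).filter fun i => c i = true).card =
      ∑ j ∈ univ.filter (fun j => a j = true), ((block (ℓ := ℓ) j).filter fun i => c i = true).card := by
    unfold blockUnion
    rw [filter_biUnion, card_biUnion]
    intro j _ j' _ h
    exact disjoint_filter_filter (block_disjoint h)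
  rw [hcard, sum_mod_two_eq_card_odd]
  have hset : (univ.filter fun i : Fin K => (a i && bpar (ℓ := ℓ) c i) = true) =
      (univ.filter fun j => a j = true).filter fun j => ((block (ℓ := ℓ) j).filter fun i => c i = true).card % 2 = 1 := by
    ext j
    simp only [mem_filter, mem_univ, true_and, Bool.and_eq_true, bpar, decide_eq_true_eq]
  rw [hset]
  split_ifs with h1 h2 h2 <;> first | rfl | omega

/-! ### Correlation of `[F = t]` with a block-union parity (Smolensky) -/

/-- The `0/1` indicator polynomial of `F = t`: `1 − (F − t)²`. -/
def indEq (F : CubeFn (ZMod 3) (K * ℓ)) (t : ZMod 3) : CubeFn (ZMod 3) (K * ℓ) := 1 - (F - fun _ => t) ^ 2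

/-- Its complement `(F − t)²`. -/
def sqEq (F : CubeFn (ZMod 3) (K * ℓ)) (t : ZMod 3) : CubeFn (ZMod 3) (K * ℓ) := (F - fun _ => t) ^ 2

/-- `z² = 1` for `z ≠ 0` in `𝔽₃`, so `indEq` is the indicator of `F = t`. -/
theorem indEq_apply (F : CubeFn (ZMod 3) (K * ℓ)) (t : ZMod 3) (c : Fin (K * ℓ) → Bool) :
    indEq F t c = if F c = t then 1 else 0 := by
  simp only [indEq, Pi.sub_apply, Pi.pow_apply, Pi.one_apply]
  have key : ∀ z t : ZMod 3, 1 - (z - t) ^ 2 = if z = t then 1 else 0 := by decide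
  exact key (F c) t

/-- `sqEq` is the indicator of `F ≠ t`. -/
theorem sqEq_apply (F : CubeFn (ZMod 3) (K * ℓ)) (t : ZMod 3) (c : Fin (K * ℓ) → Bool) :
    sqEq F t c = if F c = t then 0 else 1 := by
  simp only [sqEq, Pi.sub_apply, Pi.pow_apply]
  have key : ∀ z t : ZMod 3, (z - t) ^ 2 = if z = t then 0 else 1 := by decide
  exact key (F c) t

/-- `indEq` has degree `≤ 2D`. -/
theorem indEq_mem_lowDeg {D : ℕ} {F : CubeFn (ZMod 3) (K * ℓ)} (hF : F ∈ lowDeg (ZMod 3) (K * ℓ) D)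
    (t : ZMod 3) : indEq F t ∈ lowDeg (ZMod 3) (K * ℓ) (2 * D) := by
  have hc : (fun _ => t : CubeFn (ZMod 3) (K * ℓ)) = t • (1 : CubeFn (ZMod 3) (K * ℓ)) := by
    funext c; simp
  have h1 : (F - fun _ => t) ∈ lowDeg (ZMod 3) (K * ℓ) D := by
    rw [hc]; exact Submodule.sub_mem _ hF (Submodule.smul_mem _ _ (one_mem_lowDeg D))
  exact Submodule.sub_mem _ (one_mem_lowDeg _) (pow_mem_lowDeg h1 2)

/-- `sqEq` has degree `≤ 2D`. -/
theorem sqEq_mem_lowDeg {D : ℕ} {F : CubeFn (ZMod 3) (K * ℓ)} (hF : F ∈ lowDeg (ZMod 3) (K * ℓ) D)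
    (t : ZMod 3) : sqEq F t ∈ lowDeg (ZMod 3) (K * ℓ) (2 * D) := by
  have hc : (fun _ => t : CubeFn (ZMod 3) (K * ℓ)) = t • (1 : CubeFn (ZMod 3) (K * ℓ)) := by
    funext c; simp
  have h1 : (F - fun _ => t) ∈ lowDeg (ZMod 3) (K * ℓ) D := by
    rw [hc]; exact Submodule.sub_mem _ hF (Submodule.smul_mem _ _ (one_mem_lowDeg D))
  exact pow_mem_lowDeg h1 2

/-- `C(m, m/2)·2^{N−m} ≤ 2^N/√m` for `1 ≤ m ≤ N` (from `C(m,m/2)²·m ≤ 4^m`).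
(Adapted from the private `choose_half_le_two_pow_div_sqrt` of `SmolenskyParallelParity.lean`.) -/
theorem choose_half_mul_pow_le {m N : ℕ} (hm : 1 ≤ m) (hmN : m ≤ N) :
    ((m.choose (m / 2) : ℝ) * 2 ^ (N - m)) ≤ 2 ^ N / Real.sqrt m := by
  have hsq : m.choose (m / 2) ^ 2 * m ≤ 4 ^ m := by
    rcases Nat.even_or_odd m with ⟨r, hr⟩ | hodd
    · have h := succ_mul_centralBinom_sq_le r
      have hr2 : m = 2 * r := by omega
      subst hr2
      have hm2 : (2 * r) / 2 = r := by omega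
      rw [hm2, ← Nat.centralBinom_eq_two_mul_choose]
      calc Nat.centralBinom r ^ 2 * (2 * r) ≤ (2 * r + 1) * Nat.centralBinom r ^ 2 := by
            nlinarith [Nat.zero_le (Nat.centralBinom r ^ 2)]
        _ ≤ 16 ^ r := h
        _ = 4 ^ (2 * r) := by rw [pow_mul]; norm_num
    · exact choose_half_sq_mul_le hodd
  have hm' : (0 : ℝ) < m := by exact_mod_cast hm
  have h1 : (m.choose (m / 2) : ℝ) ≤ 2 ^ m / Real.sqrt m := by
    rw [le_div_iff₀ (Real.sqrt_pos.2 hm')]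
    have h2 : ((m.choose (m / 2) : ℝ) * Real.sqrt m) ^ 2 ≤ ((2 : ℝ) ^ m) ^ 2 := by
      rw [mul_pow, Real.sq_sqrt hm'.le, ← pow_mul,
        show (2 : ℝ) ^ (m * 2) = 4 ^ m by rw [mul_comm, pow_mul]; norm_num]
      exact_mod_cast hsq
    exact (pow_le_pow_iff_left₀ (by positivity) (by positivity) two_ne_zero).1 h2
  calc ((m.choose (m / 2) : ℝ) * 2 ^ (N - m)) ≤ 2 ^ m / Real.sqrt m * 2 ^ (N - m) :=
        mul_le_mul_of_nonneg_right h1 (by positivity)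
    _ = 2 ^ N / Real.sqrt m := by
        rw [div_mul_eq_mul_div, ← pow_add, Nat.add_sub_cancel' hmN]

/-- **Signed correlation bound**: for `F` of degree `≤ D`, `t ∈ 𝔽₃`, and a non-empty set of coordinates `T`,
`|#{F = t, parity_T even} − #{F = t, parity_T odd}| ≤ 2D·C(|T|,|T|/2)·2^{N−|T|}`. -/
theorem abs_signed_corr_le {D : ℕ} {F : CubeFn (ZMod 3) (K * ℓ)} (hF : F ∈ lowDeg (ZMod 3) (K * ℓ) D)
    (t : ZMod 3) (T : Finset (Fin (K * ℓ))) (hT : 1 ≤ T.card) :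
    |∑ c : Fin (K * ℓ) → Bool, (if F c = t then (1 : ℝ) else 0) *
        (if (T.filter fun i => c i = true).card % 2 = 1 then -1 else 1)| ≤
      2 * D * T.card.choose (T.card / 2) * (2 : ℝ) ^ (K * ℓ - T.card) := by
  have h2 : (2 : ZMod 3) ≠ 0 := by decide
  -- the four Smolensky bounds
  have hQ := paritySubset_agreement_le T h2 (indEq_mem_lowDeg hF t)
  have hQ' := paritySubset_agreement_le T h2 (sqEq_mem_lowDeg hF t)
  have h1 := paritySubset_agreement_le (F := ZMod 3) T h2 (D := 0) (one_mem_lowDeg 0)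
  have h0 := paritySubset_agreement_le (F := ZMod 3) T h2 (D := 0) (Submodule.zero_mem (lowDeg (ZMod 3) (K * ℓ) 0))
  -- `|Tᶜ| = N − |T|`
  have hTc : Tᶜ.card = K * ℓ - T.card := by rw [Finset.card_compl, Fintype.card_fin]
  rw [hTc] at hQ hQ' h1 h0
  -- rewrite the four counts as sums of indicators
  set u : (Fin (K * ℓ) → Bool) → ℝ := fun c => if F c = t then 1 else 0 with hu
  set v : (Fin (K * ℓ) → Bool) → ℝ := fun c => if (T.filter fun i => c i = true).card % 2 = 1 then 1 else 0 with hv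
  have hu01 : ∀ c, u c = 0 ∨ u c = 1 := fun c => by rw [hu]; dsimp only; split_ifs <;> simp
  have hv01 : ∀ c, v c = 0 ∨ v c = 1 := fun c => by rw [hv]; dsimp only; split_ifs <;> simp
  have h10 : (1 : ZMod 3) ≠ 0 := by decide
  have eQ : ((univ.filter fun c : Fin (K * ℓ) → Bool =>
      indEq F t c = if (T.filter fun i => c i = true).card % 2 = 1 then 1 else 0).card : ℝ) =
      ∑ c, (u c * v c + (1 - u c) * (1 - v c)) := by
    rw [natCast_card_filter]
    refine Finset.sum_congr rfl fun c _ => ?_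
    simp only [indEq_apply, hu, hv]
    by_cases hp : (T.filter fun i => c i = true).card % 2 = 1 <;> by_cases hF' : F c = t <;>
      simp [hp, hF', h10, h10.symm]
  have eQ' : ((univ.filter fun c : Fin (K * ℓ) → Bool =>
      sqEq F t c = if (T.filter fun i => c i = true).card % 2 = 1 then 1 else 0).card : ℝ) =
      ∑ c, ((1 - u c) * v c + u c * (1 - v c)) := by
    rw [natCast_card_filter]
    refine Finset.sum_congr rfl fun c _ => ?_
    simp only [sqEq_apply, hu, hv]
    by_cases hp : (T.filter fun i => c i = true).card % 2 = 1 <;> by_cases hF' : F c = t <;>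
      simp [hp, hF', h10, h10.symm]
  have e1 : ((univ.filter fun c : Fin (K * ℓ) → Bool =>
      (1 : CubeFn (ZMod 3) (K * ℓ)) c = if (T.filter fun i => c i = true).card % 2 = 1 then 1 else 0).card : ℝ) =
      ∑ c, v c := by
    rw [natCast_card_filter]
    refine Finset.sum_congr rfl fun c _ => ?_
    simp only [Pi.one_apply, hv]
    by_cases hp : (T.filter fun i => c i = true).card % 2 = 1 <;> simp [hp, h10]
  have e0 : ((univ.filter fun c : Fin (K * ℓ) → Bool =>
      (0 : CubeFn (ZMod 3) (K * ℓ)) c = if (T.filter fun i => c i = true).card % 2 = 1 then 1 else 0).card : ℝ) =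
      ∑ c, (1 - v c) := by
    rw [natCast_card_filter]
    refine Finset.sum_congr rfl fun c _ => ?_
    simp only [Pi.zero_apply, hv]
    by_cases hp : (T.filter fun i => c i = true).card % 2 = 1 <;> simp [hp, h10.symm]
  -- real forms of the four bounds
  have hpow : (2 : ℝ) ^ (K * ℓ - T.card) * 2 ^ (T.card - 1) = 2 ^ (K * ℓ - 1) := by
    rw [← pow_add]; congr 1
    have := Finset.card_le_univ T; rw [Fintype.card_fin] at this; omega
  have htot : ∑ _c : Fin (K * ℓ) → Bool, (1 : ℝ) = 2 * 2 ^ (K * ℓ - 1) := by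
    have hT' := Finset.card_le_univ T; rw [Fintype.card_fin] at hT'
    have h2 : (2 : ℝ) ^ (K * ℓ) = 2 * 2 ^ (K * ℓ - 1) := by
      rw [← pow_succ']; congr 1; omega
    rw [sum_const, card_univ, Fintype.card_fun, Fintype.card_bool, Fintype.card_fin, nsmul_eq_mul, mul_one]
    push_cast
    exact h2
  have rQ : ∑ c, (u c * v c + (1 - u c) * (1 - v c)) ≤
      2 ^ (K * ℓ - 1) + 2 * D * T.card.choose (T.card / 2) * (2 : ℝ) ^ (K * ℓ - T.card) := by
    rw [← eQ]
    calc _ ≤ ((2 ^ (K * ℓ - T.card) * (2 ^ (T.card - 1) + 2 * D * T.card.choose (T.card / 2)) : ℕ) : ℝ) := by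
          exact_mod_cast hQ
      _ = _ := by push_cast; rw [mul_add, hpow]; ring
  have rQ' : ∑ c, ((1 - u c) * v c + u c * (1 - v c)) ≤
      2 ^ (K * ℓ - 1) + 2 * D * T.card.choose (T.card / 2) * (2 : ℝ) ^ (K * ℓ - T.card) := by
    rw [← eQ']
    calc _ ≤ ((2 ^ (K * ℓ - T.card) * (2 ^ (T.card - 1) + 2 * D * T.card.choose (T.card / 2)) : ℕ) : ℝ) := by
          exact_mod_cast hQ'
      _ = _ := by push_cast; rw [mul_add, hpow]; ring
  have r1 : ∑ c, v c ≤ (2 : ℝ) ^ (K * ℓ - 1) := by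
    rw [← e1]
    calc _ ≤ ((2 ^ (K * ℓ - T.card) * (2 ^ (T.card - 1) + 0 * T.card.choose (T.card / 2)) : ℕ) : ℝ) := by
          exact_mod_cast h1
      _ = _ := by push_cast; rw [zero_mul, add_zero, hpow]
  have r0 : ∑ c, (1 - v c) ≤ (2 : ℝ) ^ (K * ℓ - 1) := by
    rw [← e0]
    calc _ ≤ ((2 ^ (K * ℓ - T.card) * (2 ^ (T.card - 1) + 0 * T.card.choose (T.card / 2)) : ℕ) : ℝ) := by
          exact_mod_cast h0
      _ = _ := by push_cast; rw [zero_mul, add_zero, hpow]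
  -- bookkeeping with linear sums
  have sv : ∑ c, v c = (2 : ℝ) ^ (K * ℓ - 1) := by
    have : ∑ c, (1 - v c) = ∑ _c : Fin (K * ℓ) → Bool, (1 : ℝ) - ∑ c, v c := by
      rw [← Finset.sum_sub_distrib]
    rw [this, htot] at r0
    linarith
  have eX : ∑ c : Fin (K * ℓ) → Bool, (if F c = t then (1 : ℝ) else 0) *
      (if (T.filter fun i => c i = true).card % 2 = 1 then -1 else 1) = ∑ c, (u c - 2 * (u c * v c)) := by
    refine Finset.sum_congr rfl fun c _ => ?_
    simp only [hu, hv]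
    split_ifs <;> ring
  rw [eX]
  have s1 : ∑ c, (u c * v c + (1 - u c) * (1 - v c)) =
      2 * ∑ c, (u c * v c) - ∑ c, u c - ∑ c, v c + ∑ _c : Fin (K * ℓ) → Bool, (1 : ℝ) := by
    simp only [← Finset.sum_sub_distrib, ← Finset.sum_add_distrib, Finset.mul_sum]
    exact Finset.sum_congr rfl fun c _ => by ring
  have s2 : ∑ c, ((1 - u c) * v c + u c * (1 - v c)) = ∑ c, u c + ∑ c, v c - 2 * ∑ c, (u c * v c) := by
    simp only [← Finset.sum_sub_distrib, ← Finset.sum_add_distrib, Finset.mul_sum]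
    exact Finset.sum_congr rfl fun c _ => by ring
  have s3 : ∑ c, (u c - 2 * (u c * v c)) = ∑ c, u c - 2 * ∑ c, (u c * v c) := by
    rw [Finset.sum_sub_distrib, Finset.mul_sum]
  rw [s3, abs_le]
  rw [s1, htot, sv] at rQ
  rw [s2, sv] at rQ'
  constructor <;> linarith

end BlockParity

end Summit.QuantumAdvantage.AdviceFreeQNC0

end
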